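import Literature.Combinatorics.StablePolynomials.ProperPosition
import HarnessLib

/-!
# `∂ⱼf ≪ f` for a real stable `f`, positive scaling of `≪`, and the Rayleigh inequalities
# (Borcea–Brändén–Liggett 2009, Remark 4.1)

Topic `Literature/Combinatorics/StablePolynomials`, namespace `Literature.Combinatorics.StablePolynomials`; companion
of `ProperPosition.lean` (`IsProperPosition f g` = Borcea–Brändén's `f ≪ g`, i.e. `g + if` stable; the half-plane
characterisation `isProperPosition_iff`; the Wronskian inequalities `IsProperPosition.wronskian_nonneg`); lane
`lit-hodgefound` (Track 2 foundations library), seat p16, generation 31 (row g31-#10).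

## Source (verbatim) — J. Borcea, P. Brändén, T. M. Liggett, *Negative dependence and the geometry of
## polynomials*, J. Amer. Math. Soc. 22 (2009) 521–567 [BorceaBrandenLiggett2007] (held: `paper:arxiv-0707.2340`,
## p. 17 of the arXiv text), §4.2

After Theorem 4.11 (= Borcea–Brändén 2009, Lemma 1.8 (1) ⇔ (3) ⇔ (5): "`g + if` is stable; `g + z_{n+1}f` is
real stable; for all `λ ∈ ℝ₊ⁿ` and `μ ∈ ℝⁿ` we have `f(λt + μ) ≪ g(λt + μ)`") and the definition "We say that the
polynomials `f, g ∈ ℝ[z₁,…,zₙ]` are in proper position, written `f ≪ g`, if any of the equivalent conditions in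
Theorem 4.11 are satisfied": **Remark 4.1.** "The typical proper position is between a real stable polynomial
and any of its partial derivatives: if `f ∈ ℝ[z₁,…,zₙ]` is real stable then `∂ⱼf ≪ f` for all `j ∈ [n]`. […]
Note also that by Theorem 4.11 (3) one has `f ≪ g ⇔ αf ≪ βg` for any `α, β ∈ ℝ₊`."

## What is here

* §1 `isRealStable_C_mul_iff`, **`isProperPosition_C_mul_iff`** — `αf ≪ βg ↔ f ≪ g` for `α, β > 0`.
* §2 `IsUpperHalfPlaneStable.im_eval_pderiv_div_nonpos` — for a stable `F ∈ ℂ[z₁,…,zₙ]` and `z ∈ ℋⁿ`,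
  `Im (∂ⱼF(z)/F(z)) ≤ 0` (logarithmic derivative along the coordinate line through `z`: the zeros `ρ` of
  `t ↦ F(z + teⱼ)` have `Im ρ < 0`, and `∂ⱼF(z)/F(z) = Σ 1/(0 − ρ)`); **`IsRealStable.isProperPosition_pderiv`** —
  `∂ⱼf ≪ f` for every real stable `f` (Remark 4.1).
* §3 **`IsRealStable.eval_rayleighDiff_nonneg`** — consequently `Δᵢⱼ(f)(x) = (∂ᵢf·∂ⱼf − ∂ᵢ∂ⱼf·f)(x) ≥ 0` for
  every real stable `f` (not necessarily multi-affine) and every real `x`: the Wronskian inequality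
  `Wᵢ[f, ∂ⱼf] ≥ 0` of Borcea–Brändén 2009, Theorem 1.9 for the pair `∂ⱼf ≪ f`. (For multi-affine `f` this is
  Brändén 2007, Thm. 5.6 (2) ⇒ (1), the tree's `rayleighDiff_nonneg_of_isRealStable`.)

## Proof route

`∂ⱼf ≪ f` is obtained from the half-plane characterisation (`IsProperPosition.of_im_eval_mul_conj_nonpos`): `∂ⱼf`
is real stable or zero (tree `IsUpperHalfPlaneStable.pderiv`, Gauss–Lucas), and `Im (∂ⱼF · conj F) =
|F|² Im (∂ⱼF/F) ≤ 0` on `ℋⁿ` by §2, which uses the tree's `linePoly` and Mathlib's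
`Polynomial.Splits.eval_derivative_div_eval_of_ne_zero`. (BBL derive Remark 4.1 from [BBS2]; no proof is printed.)

## References

* [BorceaBrandenLiggett2007] J. Borcea, P. Brändén, T. M. Liggett, *Negative dependence and the geometry of
  polynomials*, J. Amer. Math. Soc. 22 (2009) 521–567, arXiv:0707.2340 — §4.2, Theorem 4.11 and Remark 4.1.
* [BorceaBranden2009] J. Borcea, P. Brändén, *The Lee–Yang and Pólya–Schur programs. I*, Invent. Math. 177 (2009)
  — §1 Definition 1.1, Lemma 1.8, Theorem 1.9 (the Wronskians `Wⱼ[g,f] ≥ 0` for `f ≪ g`).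
* [Branden2007] P. Brändén, *Polynomials with the half-plane property and matroid theory*, Adv. Math. 216 (2007)
  — §5, the Rayleigh difference `Δᵢⱼ` and Theorem 5.6.
-/

noncomputable section

open scoped BigOperators Polynomial ComplexConjugate
open MvPolynomial Set

namespace Literature.Combinatorics.StablePolynomials

variable {σ : Type*}

/-! ## §1 Positive scaling -/

section Scaling

/-- `a·f` is real stable iff `f` is, for a real `a ≠ 0`. [cite: BorceaBrandenLiggett2007, §4.2 Remark 4.1
("`f ≪ g ⇔ αf ≪ βg` for any `α, β ∈ ℝ₊`")] -/
theorem isRealStable_C_mul_iff {a : ℝ} (ha : a ≠ 0) (f : MvPolynomial σ ℝ) :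
    IsRealStable (C a * f) ↔ IsRealStable f := by
  have haC : algebraMap ℝ ℂ a ≠ 0 := by simpa using ha
  simp only [IsRealStable, map_mul, map_C, isUpperHalfPlaneStable_mul_iff]
  exact ⟨fun h => h.2, fun h => ⟨isUpperHalfPlaneStable_C haC, h⟩⟩

variable [Fintype σ]

/-- **Positive scaling** (Borcea–Brändén–Liggett, Remark 4.1): `αf ≪ βg ↔ f ≪ g` for `α, β > 0`.
[cite: BorceaBrandenLiggett2007, §4.2 Remark 4.1] -/
theorem isProperPosition_C_mul_iff {a b : ℝ} (ha : 0 < a) (hb : 0 < b) (f g : MvPolynomial σ ℝ) :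
    IsProperPosition (C a * f) (C b * g) ↔ IsProperPosition f g := by
  have hfa : C a * f = 0 ↔ f = 0 := by simp [ha.ne']
  have hgb : C b * g = 0 ↔ g = 0 := by simp [hb.ne']
  have hW : ∀ z : σ → ℂ,
      (eval z (map (algebraMap ℝ ℂ) (C a * f)) * conj (eval z (map (algebraMap ℝ ℂ) (C b * g)))).im =
        (a * b) * (eval z (map (algebraMap ℝ ℂ) f) * conj (eval z (map (algebraMap ℝ ℂ) g))).im := by
    intro z
    simp only [map_mul, map_C, eval_C, Complex.coe_algebraMap, map_mul (starRingEnd ℂ), Complex.conj_ofReal]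
    rw [show (a : ℂ) * eval z (map (algebraMap ℝ ℂ) f) * ((b : ℂ) * conj (eval z (map (algebraMap ℝ ℂ) g))) =
        ((a * b : ℝ) : ℂ) * (eval z (map (algebraMap ℝ ℂ) f) * conj (eval z (map (algebraMap ℝ ℂ) g))) by
      push_cast
      ring, Complex.im_ofReal_mul]
  have hab : 0 < a * b := mul_pos ha hb
  rw [isProperPosition_iff, isProperPosition_iff, isRealStable_C_mul_iff ha.ne', isRealStable_C_mul_iff hb.ne',
    hfa, hgb]
  simp only [hW]
  refine ⟨fun h => ⟨h.1, h.2.1, h.2.2.1, fun z hz => ?_⟩, fun h => ⟨h.1, h.2.1, h.2.2.1, fun z hz => ?_⟩⟩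
  · exact le_of_mul_le_mul_left (by rw [mul_zero]; exact h.2.2.2 z hz) hab
  · exact mul_nonpos_of_nonneg_of_nonpos hab.le (h.2.2.2 z hz)

end Scaling

/-! ## §2 `∂ⱼ f ≪ f` -/

section Pderiv

/-- A finite sum of complex numbers with nonpositive imaginary parts has nonpositive imaginary part.
[cite: BorceaBrandenLiggett2007, §4.2 Remark 4.1 (proof device)] -/
private theorem im_multiset_sum_nonpos {s : Multiset ℂ} (h : ∀ x ∈ s, x.im ≤ 0) : s.sum.im ≤ 0 := by
  induction s using Multiset.induction_on with
  | empty => simp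
  | cons a s ih =>
    rw [Multiset.sum_cons, Complex.add_im]
    exact add_nonpos (h a (Multiset.mem_cons_self a s)) (ih fun x hx => h x (Multiset.mem_cons_of_mem hx))

variable [Fintype σ]

/-- **`Im (∂ⱼF(z)/F(z)) ≤ 0` on `ℋⁿ` for a stable `F ∈ ℂ[z₁,…,zₙ]`.** The univariate `R(t) = F(z + teⱼ)` has all
its zeros `ρ` in `{Im ρ < 0}` (as `z + ρeⱼ ∉ ℋⁿ`), and `∂ⱼF(z)/F(z) = R'(0)/R(0) = Σ_ρ 1/(0 − ρ)` with
`Im (1/(−ρ)) = Im ρ/|ρ|² < 0`. [cite: BorceaBrandenLiggett2007, §4.2 Remark 4.1 ("`∂ⱼf ≪ f`")] -/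
theorem IsUpperHalfPlaneStable.im_eval_pderiv_div_nonpos {F : MvPolynomial σ ℂ} (hF : IsUpperHalfPlaneStable F)
    (j : σ) {z : σ → ℂ} (hz : ∀ i, 0 < (z i).im) :
    (eval z (MvPolynomial.pderiv j F) / eval z F).im ≤ 0 := by
  classical
  set v : σ → ℂ := Pi.single j 1 with hv
  set R := linePoly F z v with hR
  have hRt : ∀ t, R.eval t = eval (fun k => z k + t * v k) F := fun t => eval_linePoly F z v t
  have hpt0 : (fun k => z k + (0 : ℂ) * v k) = z := by
    funext k
    simp
  have hR0 : R.eval 0 = eval z F := by rw [hRt, hpt0]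
  have hR'0 : R.derivative.eval 0 = eval z (MvPolynomial.pderiv j F) := by
    rw [hR, derivative_linePoly, Polynomial.eval_finsetSum]
    simp only [Polynomial.eval_mul, Polynomial.eval_C, eval_linePoly, hv, Pi.single_apply, ite_mul, one_mul,
      zero_mul, add_zero, Finset.sum_ite_eq', Finset.mem_univ, if_true]
  have hFz : eval z F ≠ 0 := hF z hz
  have hRne0 : R.eval 0 ≠ 0 := by rwa [hR0]
  have hroots : ∀ ρ ∈ R.roots, ρ.im < 0 := by
    intro ρ hρ
    have hev : R.eval ρ = 0 := (Polynomial.mem_roots'.1 hρ).2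
    by_contra hge
    push Not at hge
    refine hF (fun k => z k + ρ * v k) (fun k => ?_) (by rw [← hRt]; exact hev)
    by_cases hk : k = j
    · subst hk
      simp only [hv, Pi.single_eq_same, mul_one, Complex.add_im]
      linarith [hz k]
    · simp [hv, hk, hz k]
  have hsum := (IsAlgClosed.splits R).eval_derivative_div_eval_of_ne_zero hRne0
  rw [hR'0, hR0] at hsum
  rw [hsum]
  refine im_multiset_sum_nonpos fun x hx => ?_
  obtain ⟨ρ, hρ, rfl⟩ := Multiset.mem_map.1 hx
  rw [zero_sub, one_div, Complex.inv_im, Complex.neg_im, neg_neg]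
  exact div_nonpos_of_nonpos_of_nonneg (hroots ρ hρ).le (Complex.normSq_nonneg _)

/-- **`∂ⱼf ≪ f` for every real stable `f`** (Borcea–Brändén–Liggett, Remark 4.1: "The typical proper position is
between a real stable polynomial and any of its partial derivatives"). Via the half-plane characterisation:
`∂ⱼf` is real stable or zero (Gauss–Lucas, tree `IsUpperHalfPlaneStable.pderiv`) and
`Im (∂ⱼF(z) · conj F(z)) = |F(z)|² · Im (∂ⱼF(z)/F(z)) ≤ 0` on `ℋⁿ`.
[cite: BorceaBrandenLiggett2007, §4.2 Remark 4.1] -/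
theorem IsRealStable.isProperPosition_pderiv {f : MvPolynomial σ ℝ} (hf : IsRealStable f) (j : σ) :
    IsProperPosition (pderiv j f) f := by
  classical
  have hpd : pderiv j f = 0 ∨ IsRealStable (pderiv j f) := by
    have h := IsUpperHalfPlaneStable.pderiv hf j
    rw [pderiv_map] at h
    rcases h with h | h
    · exact Or.inl (MvPolynomial.map_injective (algebraMap ℝ ℂ) (RingHom.injective _) (by rw [h, map_zero]))
    · exact Or.inr h
  have hf0 : f ≠ 0 := by
    rintro rfl
    exact hf (fun _ => Complex.I) (fun _ => by simp) (by simp)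
  refine IsProperPosition.of_im_eval_mul_conj_nonpos hpd (Or.inr hf) (fun h => hf0 h.2) fun z hz => ?_
  have hFz : eval z (map (algebraMap ℝ ℂ) f) ≠ 0 := hf z hz
  have key := IsUpperHalfPlaneStable.im_eval_pderiv_div_nonpos hf j hz
  rw [pderiv_map] at key
  have hid : eval z (map (algebraMap ℝ ℂ) (pderiv j f)) * conj (eval z (map (algebraMap ℝ ℂ) f)) =
      (Complex.normSq (eval z (map (algebraMap ℝ ℂ) f)) : ℂ) *
        (eval z (map (algebraMap ℝ ℂ) (pderiv j f)) / eval z (map (algebraMap ℝ ℂ) f)) := by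
    rw [← Complex.mul_conj]
    field_simp
  rw [hid, Complex.im_ofReal_mul]
  exact mul_nonpos_of_nonneg_of_nonpos (Complex.normSq_nonneg _) key

end Pderiv

/-! ## §3 The Rayleigh inequalities for every real stable polynomial -/

section Rayleigh

variable [Fintype σ]

/-- **`Δᵢⱼ(f)(x) ≥ 0` for every real stable `f` and every real point `x`**, where
`Δᵢⱼ(f) = ∂ᵢf·∂ⱼf − ∂ᵢ∂ⱼf·f` (`rayleighDiff`): the Wronskian inequality `Wᵢ[f, ∂ⱼf](x) ≥ 0` of Borcea–Brändén
2009, Theorem 1.9 for the pair `∂ⱼf ≪ f` of Remark 4.1. (No multi-affinity assumption; for multi-affine `f` this is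
the tree's `rayleighDiff_nonneg_of_isRealStable`, Brändén 2007 Thm. 5.6 (2) ⇒ (1).)
[cite: BorceaBrandenLiggett2007, §4.2 Remark 4.1] [cite: BorceaBranden2009, §1 Theorem 1.9 ("if `f ≪ g` then
`Wⱼ[g,f](x) ≥ 0`")] [cite: Branden2007, §5 (Δᵢⱼ)] -/
theorem IsRealStable.eval_rayleighDiff_nonneg {f : MvPolynomial σ ℝ} (hf : IsRealStable f) (x : σ → ℝ) (i j : σ) :
    0 ≤ eval x (rayleighDiff i j f) := by
  have h := (hf.isProperPosition_pderiv j).wronskian_nonneg x i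
  have e : eval x (rayleighDiff i j f) = eval x (pderiv i f * pderiv j f - f * pderiv i (pderiv j f)) := by
    simp only [rayleighDiff, map_sub, map_mul]
    ring
  rw [e]
  exact h

end Rayleigh

end Literature.Combinatorics.StablePolynomials
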